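import Literature.Geometry.Lorentzian.KlainermanSzeftel2021.SupToFluxExponents
import Literature.Geometry.Lorentzian.KlainermanSzeftel2021.NearZoneCount
import Literature.Geometry.Lorentzian.KlainermanSzeftel2021.MixedRateCount

/-!
# Klainerman–Szeftel Lemma 9.4.13 at the REFEREED rates: the sup-to-norm exponent count re-instantiated (audit item K20b-J)

CITATION HEADER (lean-in-tree rule 2026-08-18).  Arithmetic of exponents read off two versions of one text:

* `[v1]` S. Klainerman, J. Szeftel, *Kerr stability for small angular momentum*, arXiv:2104.11857 v1 (2021), TeX source
  `Main-Kerr-arxiv.tex` (`TeX l.N`) = bib key `KlainermanSzeftel2021` — the version the companion modules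
  `…SupToFluxExponents`, `…MixedRateCount`, `…NearZoneCount`, `…OutgoingTransportCount`, `…ATermCount` count;
* `[J]` the refereed version, Pure Appl. Math. Q. **19** (2023) no. 3, 791–1678 = bib key `KlainermanSzeftel2023`, read in the
  authors' accepted manuscript HAL hal-04280491 (`HAL p. N` = PDF page `N` of that file, `L n` = line of its text layer; not a
  journal page).  Equation numbers of `[J]` §9.4 are those of `[v1]` shifted: `(9.4.1)–(9.4.19)` unchanged, `[v1] (9.4.20)–(9.4.22)
  = [J] (9.4.21)–(9.4.23)`, `[v1] (9.4.23)–(9.4.36) = [J] (9.4.25)–(9.4.38)` (`[J]` inserts (9.4.20) and (9.4.24)).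

THE DRIFT this module records.  The one-sentence step of the proof of Lemma 9.4.13 — "The weights in `r`, `u` and `u̲` are
enough to take care of the spacetime integrations in the global norms defined in section 9.4.1 for the PT frames of `𝓜`, and we
finally obtain `𝔊_{k_small−1} + ℜ_{k_small−1} ≲ ε₀`" (`[v1]` TeX l.24420–24425 after display l.24414–24419; `[J]` HAL p. 626
L30–37 after (9.4.32)) — is fed by DIFFERENT printed sup-bounds in the two versions:

* `[v1]` l.24414–24419 (unnumbered) and its source display l.24364–24369:
  `sup_{ᵉˣᵗ𝓜 ∪ ᵗᵒᵖ𝓜′(r ≥ r₀)} { r² u^{1/2+δ_dec} |𝔡^{≤k}Γ'_g| + r u^{1+δ_dec} |𝔡^{≤k}Γ'_b| } + … ≲ ε₀`;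
* `[J]` (9.4.24) = HAL p. 624 L7–27, repeated as (9.4.32) p. 626:
  `sup_{ᵉˣᵗ𝓜 ∪ ᵗᵒᵖ𝓜′(r ≥ r₀)} { (r u^{1/2+δ_dec} + u^{1+3δ_dec/4}) |𝔡^{≤k}Γ'_g| + r u^{1+3δ_dec/4} |𝔡^{≤k}Γ'_b| }
   + sup_{ᵗᵒᵖ𝓜′(r ≤ r₀) ∪ ⁱⁿᵗ𝓜′} u^{1+3δ_dec/4} { |𝔡^{≤k}Γ'_g| + |𝔡^{≤k}Γ'_b| } ≲ ε₀`,
  while the PG-frame INPUT keeps the square: `[J]` (9.4.25) p. 624 L30–48 `(r² u^{1/2+δ_dec} + r u^{1+δ_dec})|𝔡^{≤k}Γ_g| +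
  r u^{1+δ_dec}|𝔡^{≤k}Γ_b|` "in view of Theorem M7" (same page, same fonts: the text layer prints `r2u` there and `ru` in (9.4.24),
  so the missing square is not an extraction artefact; the corpus TeX `paper:arxiv-2104.11857` is `[v1]` and cannot arbitrate).
  The frame data are unchanged: `f = 0`, `λ = 1`, `e'_4 = e_4` (`[J]` p. 624 item 1(a) = `[v1]` l.24380–24390); the frame
  coefficient `f̲` obeys `[J]` (9.4.29) p. 625 L24–38 `sup_{ᵉˣᵗ𝓜} (r u^{1/2+δ_dec} + u^{1+3δ_dec/4})|𝔡^{≤k_small} f̲| ≲ ε₀`, whose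
  branch I is `[v1]`'s bound l.24398–24400 `sup_{ᵉˣᵗ𝓜} r u^{1/2+δ_dec}|𝔡^{≤k_small} f̲| ≲ ε₀` VERBATIM — the `r`-power of `f̲`'s
  printed rate is the same in both versions (`[J]` adds the `u`-branch), so the drift recorded here sits in the OUTPUT of the
  transfer step (item 5), not in its input; Definition 9.2.4 of `(Γ_g, Γ_b)` for the outgoing PT frame (`[J]` (9.2.4)–(9.2.5)
  p. 601–602 = `[v1]` l.23386–23408, verbatim) and the norms (9.4.1)–(9.4.4) (`[J]` p. 612–613 = `[v1]` l.23870–23917, verbatim)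
  are the SAME in both versions.

So the `r`-exponent of the printed `Γ'_g` sup-weight drops from `2` (`gExpV1`) to `1` (`gExpJ`, branch I; branch II `u^{1+3δ_dec/4}`
has `r`-exponent `0` and is inactive wherever `u ≤ r²`, `branchI_le_branchII`), the `Γ'_b` exponent stays `1` (`bExp`).  This module
redoes, member by member, the count "sup-weight ⇒ hypersurface / bulk power" of the companion file with the exponent of the
`Γ'_g`-weight as a PARAMETER and instantiates it at both printed values.  Bookkeeping (Definition 9.2.4): a norm entry `ψ` with
`r^s ψ ∈ Γ` inherits the pointwise rate `r^{-(e+s)}` from a sup-weight `r^e` on `Γ` (`rate e s`); on a hypersurface `{r = λ}` of `ᵉˣᵗ𝓜`,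
on `Σ_*` (`r ≍ r_*`) and on a sphere of `Σ_*` (area `≍ λ²`, `u`-integral convergent by the `u`-weights) a weight-`r^w` entry then
carries `λ^{hsPower w a} = λ^{w+2−2a}`, bounded uniformly in `λ ≤ R → ∞` iff `hsPower ≤ 0` (`hs_bounded_of_nonpos`,
`hs_unbounded_of_pos`); in the bulk `ᵉˣᵗℜ` and on a cone `{u = u₁}` the radial integrand is `r^{w+2−2a} = r^{-1-margin}` as in the
companion file.

THE TABLE (`§3`; `δ_B > 0` from `[v1]` (3.4.4) l.6076–6081 = `[J]` (3.4.4)):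
| norm entry (weight `r^w`)                         | `s` | `[v1]` power | `[J]` power |
| `ᵉˣᵗ𝔊`, `⋆𝔊`: `r²|(X̂, trX̌, Ž)|²` (`⋆𝔊`: `+trX̲̌`)   | 0 (Γ_g) | `0`   | `2`        (`ricciBlock`) |
| `ᵉˣᵗ𝔊`: `r^{2−δ_B}|trX̲̌|²`                          | 0 (Γ_g) | `−δ_B` | `2 − δ_B` (`trXbBlock`) |
| `ᵉˣᵗ𝔊`, `⋆𝔊`: `|Dr|²`                               | −1 (Γ_g) | `0`  | `2`        (`drBlock`) |
| `⋆ℜ`: `r^{4+δ_B}|(A,B)|²`                           | 1 (Γ_g) | `δ_B` | `2 + δ_B`  (`starAB`; `[v1]` = companion `starPowerB_recorded`) |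
| `⋆ℜ`: `r⁴|P̌|²`                                    | 1 (Γ_g) | `0`   | `2`        (`starP`) |
| `L_*²` sphere term `r²|𝔡̄Γ_g|²` ((9.4.34)/(9.4.36))   | Γ-level | `0`  | `2`        (`lstarSphereG`) |
| every `Γ_b` entry (`X̲̂,Ȟ,ω̲̌`; `Ξ̲`; `ě₃(r)`; `cos θ` terms; `J` terms; `B̲`; `A̲`; `L_*` sphere `Γ_b`) | | `0`/`−δ_B` | unchanged (`gammaB_entries`) |
| bulk/cone `r^{3+δ_B}|(A,B)|²`: margin                | 1 (Γ_g) | `−δ_B` (K20b′) | `−2 − δ_B` (`bulkAB`) |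
| bulk/cone `r^{3−δ_B}|P̌|²`: margin                   | 1 (Γ_g) | `+δ_B` | `−2 + δ_B` (`bulkP`; negative for `δ_B < 2`) |
| bulk/cone `B̲`, `A̲`: margin                          | Γ_b | `+δ_B` | `+δ_B` |
At the outer radius `R = r_* = δ_* ε₀^{-1} u_*^{1+δ_dec}` (`[v1]` (3.4.5) l.6103–6106 = `[J]` (3.4.5)) a power `2` costs exactly the
factor that turns `ε₀²` into `δ_*² u_*^{2+2δ_dec}` (`eps_sq_rstar_sq`), unbounded in `u_*`; §4 shows the second branch of (9.4.24) does not
help on `{r = λ}` (`ricciSlab_integral`, `ricciSlab_unbounded` vs `ricci_v1_bounded`).  §6 records that putting the parameter back to `2`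
returns every line of the table to the companion file's (`v1_table`), whose only supercritical entries are the `(A,B)` ones (K20b′).
§7 re-instantiates the two companion counts that priced the `(A,B)` residue at `[v1]` — the NEAR-ZONE `u`-count (`…NearZoneCount`)
and the MIXED count with BA-B (`…MixedRateCount`) — at the `[J]` print read literally (PT profile of `B'` = branch I `r^{-2}u^{-1/2-δ}`,
branch II `r^{-1}u^{-1-3δ/4}`): both zone exponents move up by at least `1` and are never `u`-integrable (`zones_J_not_integrable`,
`zoneII_J_unbounded`), and the mixing parameter becomes `μ_J = 2 + δ_B`, outside the window `μ < 2δ_dec` for every `δ_B > 0`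
(`mixingWindow_J_fails`).  The inputs of those companion counts are PG-frame theorems (Theorem M7's decay norm, the ch. 6 improved
rate for `B`, BA-B, Theorem M1 item 2 — whose common weight `r³(2r+u)^{1/2+δ_extra}|𝔡^k A|` is the same in `[J]`, HAL p. 157
L78–107, as in `[v1]` l.6684–6687, while the OTHER (first) weight of item 2, not used by any count here, changed from `[v1]`
`r²(2r+u)^{1+δ_extra} log(1+u)^{-1}|𝔡^k A|` to `[J]` `r² u^{1+δ_extra}|𝔡^k A|` (HAL p. 157 L81): both `(2r+u) ↦ u` and the removal
of `log(1+u)^{-1}` — v4 precision, cell REFEREE.md #28 P2); their transfer to the PT frame is not what (9.4.24) prints, and §7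
records only what the literal `[J]` sup-bound gives in their place.

STATUS.  Census observation of the audit cell `pub-kerr` (GAPS.md lead block 16 item (4) "K20b-J"; f3 block 17), typed as arithmetic
over Mathlib and the companion module; UNDER ADJUDICATION there.  Nothing here asserts that Lemma 9.4.13 or (9.4.33) is false: the
module records which exponent inequalities the quoted one-sentence step needs when fed the sup-bound PRINTED in each version, and that
the refereed print supplies strictly less than the arXiv print at that step (the arXiv weight `r²` is not printed in `[J]`, and neither
version prints a derivation of the `Γ'_g` weight from (9.4.25) member by member).  KS is a refereed publication; nothing here is
Final-State-Conjecture progress.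
-/

open Real Set MeasureTheory intervalIntegral Filter

noncomputable section

namespace Literature.Geometry.Lorentzian.KlainermanSzeftel2021.RefereedRateCount

open Literature.Geometry.Lorentzian.KlainermanSzeftel2021.SupToFluxExponents

/-! ## §1 The printed sup-weights (two versions) and the Definition 9.2.4 bookkeeping -/

/-- `[v1]`: `r`-exponent `2` of the sup-weight `r² u^{1/2+δ_dec}` on `|𝔡^{≤k}Γ'_g|` over `ᵉˣᵗ𝓜 ∪ ᵗᵒᵖ𝓜′(r ≥ r₀)`.
[cite: KlainermanSzeftel2021, proof of Lemma 9.4.13, display before "The weights in r, u", TeX l.24414–24419; source display l.24364–24369] -/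
def gExpV1 : ℝ := 2

/-- `[J]`: `r`-exponent `1` of branch I `r u^{1/2+δ_dec}` of the sup-weight on `|𝔡^{≤k}Γ'_g|` in (9.4.24) = (9.4.32).
[cite: KlainermanSzeftel2023, Lemma 9.4.13 (9.4.24), HAL hal-04280491 p. 624 L7–27; (9.4.32) p. 626] -/
def gExpJ : ℝ := 1

/-- `[J]`: `r`-exponent `0` of branch II `u^{1+3δ_dec/4}` of the sup-weight on `|𝔡^{≤k}Γ'_g|` in (9.4.24).
[cite: KlainermanSzeftel2023, Lemma 9.4.13 (9.4.24), HAL hal-04280491 p. 624 L7–27] -/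
def gExpJ' : ℝ := 0

/-- Both versions: `r`-exponent `1` of the sup-weight on `|𝔡^{≤k}Γ'_b|` (`r u^{1+δ_dec}` in `[v1]`, `r u^{1+3δ_dec/4}` in `[J]`).
[cite: KlainermanSzeftel2021, TeX l.24414–24419; KlainermanSzeftel2023, (9.4.24), HAL p. 624] -/
def bExp : ℝ := 1

/-- `u`-exponent of branch I (both versions, `Γ'_g`): `1/2 + δ_dec`.  [cite: KlainermanSzeftel2023, (9.4.24), HAL p. 624] -/
def uExpI (δdec : ℝ) : ℝ := 1 / 2 + δdec

/-- `u`-exponent of branch II and of the `Γ'_b` weight in `[J]`: `1 + 3δ_dec/4`.  [cite: KlainermanSzeftel2023, (9.4.24), HAL p. 624] -/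
def uExpII (δdec : ℝ) : ℝ := 1 + 3 * δdec / 4

/-- Definition 9.2.4 bookkeeping: a norm entry `ψ` listed in `Γ` as `r^s ψ` inherits from a sup-weight `r^e` on `|Γ|` the pointwise
rate `r^{-(e+s)}`.  Values of `s`: `0` for `trX̌, X̂, Ž, trX̲̌` (Γ_g) and `Ȟ, X̲̂, ω̲̌, Ξ̲, A̲, Ď(cos θ), e₃(cos θ), Ďu` (Γ_b); `1` for
`P̌, B, A` (Γ_g) and `B̲, D̄·J̌, D⊗̂J, ∇̌₃J` (Γ_b); `−1` for `∇(r)` (Γ_g) and `ě₃(r), ě₃(u)` (Γ_b).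
[cite: KlainermanSzeftel2023, Definition 9.2.4 (9.2.4)–(9.2.5), HAL p. 601–602; KlainermanSzeftel2021, TeX l.23386–23408 (verbatim the same)] -/
def rate (e s : ℝ) : ℝ := e + s

/-- Power of `λ` carried by a weight-`r^w` entry at pointwise rate `r^{-a}` on a hypersurface `{r = λ}` of `ᵉˣᵗ𝓜`, on `Σ_*` (`r ≍ r_*`),
or on a sphere of `Σ_*` (area `≍ λ²`; the `u`-integration converges by the `u`-weights): `w + 2 − 2a`.  Same expression as the
companion file's radial integrand exponent (`exponent_eq`: `= −1 − margin w a`).  [folklore] -/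
def hsPower (w a : ℝ) : ℝ := w + 2 - 2 * a

/-- `hsPower` and the companion file's `margin` are the same bookkeeping.  [folklore] -/
theorem hsPower_eq_margin (w a : ℝ) : hsPower w a = -1 - margin w a := by unfold hsPower margin; ring

/-- The `[v1]` parameter reproduces the companion file's RECORDED rates: `(A, B, P̌)` at `3`, `B̲` at `2`, `A̲` at `1`.
[cite: KlainermanSzeftel2021, proof of Lemma 9.4.13, TeX l.24364–24369 with Definition 9.2.4 l.23386–23408] -/
theorem v1_rates : rate gExpV1 1 = rateABP_recorded ∧ rate bExp 1 = rateBb_recorded ∧ rate bExp 0 = rateAb_recorded := by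
  unfold rate gExpV1 bExp rateABP_recorded rateBb_recorded rateAb_recorded; norm_num

/-- The `[J]` parameter: `(A, B, P̌)` at `2` (branch I), the `Γ_b` members as in `[v1]`.
[cite: KlainermanSzeftel2023, (9.4.24) HAL p. 624 with Definition 9.2.4 p. 601–602] -/
theorem J_rates : rate gExpJ 1 = 2 ∧ rate gExpJ 0 = 1 ∧ rate gExpJ (-1) = 0 ∧ rate bExp 1 = 2 ∧ rate bExp 0 = 1 ∧
    rate bExp (-1) = 0 := by
  unfold rate gExpJ bExp; norm_num

/-! ## §2 Hypersurface powers: bounded iff nonpositive -/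

/-- A nonpositive power is harmless: `λ^p ≤ 1` for `λ ≥ 1`, uniformly.  [folklore] -/
theorem hs_bounded_of_nonpos {p lam : ℝ} (hp : p ≤ 0) (hl : 1 ≤ lam) : lam ^ p ≤ 1 :=
  Real.rpow_le_one_of_one_le_of_nonpos hl hp

/-- A positive power is not: `sup_{λ ≤ R} λ^p ≥ R^p → ∞`.  [folklore] -/
theorem hs_unbounded_of_pos {p : ℝ} (hp : 0 < p) : Tendsto (fun lam : ℝ => lam ^ p) atTop atTop :=
  tendsto_rpow_atTop hp

/-! ## §3 The table, both versions -/

/-- Principal Ricci block `r²|𝔡^{≤k}(X̂, trX̌, Ž)|²` of `ᵉˣᵗ𝔊_k` (9.4.3) and `r²|𝔡^{≤k}(X̂, trX̌, Ž, trX̲̌)|²` of `⋆𝔊_k` (9.4.1)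
(`s = 0`): power `0` in `[v1]`, `2` in `[J]`.
[cite: KlainermanSzeftel2023, (9.4.1) HAL p. 612 L3–13, (9.4.3) p. 612 L71–82, (9.4.24) p. 624; KlainermanSzeftel2021, TeX l.23870–23880, l.23896–23910, l.24414–24419] -/
theorem ricciBlock : hsPower 2 (rate gExpV1 0) = 0 ∧ hsPower 2 (rate gExpJ 0) = 2 := by
  unfold hsPower rate gExpV1 gExpJ; norm_num

/-- `ᵉˣᵗ𝔊_k` entry `r^{2−δ_B}|𝔡^{≤k} trX̲̌|²` (`s = 0`, Γ_g): power `−δ_B` in `[v1]`, `2 − δ_B` in `[J]`.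
[cite: KlainermanSzeftel2023, (9.4.3) HAL p. 612 L79, (9.4.24) p. 624; KlainermanSzeftel2021, TeX l.23896–23910] -/
theorem trXbBlock (δB : ℝ) : hsPower (2 - δB) (rate gExpV1 0) = -δB ∧ hsPower (2 - δB) (rate gExpJ 0) = 2 - δB := by
  unfold hsPower rate gExpV1 gExpJ; constructor <;> ring

/-- `|𝔡^{≤k} Dr|²` in `ᵉˣᵗ𝔊_k` and `⋆𝔊_k` (weight `r⁰`; `r^{-1}∇(r) ∈ Γ_g`, `s = −1`): power `0` in `[v1]`, `2` in `[J]` (branch I gives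
`|∇'(r)| ≲ ε₀ u^{-1/2-δ_dec}` with no `r`-decay).
[cite: KlainermanSzeftel2023, (9.4.1) p. 612 L20, (9.4.3) p. 612 L90, Definition 9.2.4 p. 601, (9.4.24) p. 624; KlainermanSzeftel2021, TeX l.23386–23408] -/
theorem drBlock : hsPower 0 (rate gExpV1 (-1)) = 0 ∧ hsPower 0 (rate gExpJ (-1)) = 2 := by
  unfold hsPower rate gExpV1 gExpJ; norm_num

/-- `⋆ℜ_k` entry `r^{4+δ_B}(|𝔡^{≤k}A|² + |𝔡^{≤k}B|²)` on `Σ_*` (`rA, rB ∈ Γ_g`, `s = 1`): power `δ_B` in `[v1]` (the companion file's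
`starPowerB_recorded`), `2 + δ_B` in `[J]`.
[cite: KlainermanSzeftel2023, (9.4.2) HAL p. 612 L56–67, (9.4.24) p. 624; KlainermanSzeftel2021, TeX l.23886–23889] -/
theorem starAB (δB : ℝ) : hsPower (wABstar δB) (rate gExpV1 1) = δB ∧ hsPower (wABstar δB) (rate gExpJ 1) = 2 + δB ∧
    hsPower (wABstar δB) (rate gExpV1 1) = wABstar δB + 2 - 2 * rateABP_recorded := by
  unfold hsPower rate gExpV1 gExpJ wABstar rateABP_recorded; refine ⟨by ring, by ring, by ring⟩

/-- `⋆ℜ_k` entry `r⁴|𝔡^{≤k}P̌|²` (`rP̌ ∈ Γ_g`, `s = 1`): power `0` in `[v1]`, `2` in `[J]`.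
[cite: KlainermanSzeftel2023, (9.4.2) HAL p. 612 L65, (9.4.24) p. 624] -/
theorem starP : hsPower 4 (rate gExpV1 1) = 0 ∧ hsPower 4 (rate gExpJ 1) = 2 := by
  unfold hsPower rate gExpV1 gExpJ; norm_num

/-- The sphere term of `L_*²(k)`: `∫_{Σ_* ∩ {u = u'_*}} r²|𝔡̄^{≤k}Γ_g|²` ((9.4.34)–(9.4.35) of `[v1]` = (9.4.36)–(9.4.37) of `[J]`; area
`≍ r_*²`, weight `r²`, `Γ_g` at rate `r^{-e}`): power `0` in `[v1]`, `2` in `[J]`.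
[cite: KlainermanSzeftel2021, (9.4.34)–(9.4.35) TeX l.24452–24461; KlainermanSzeftel2023, (9.4.36)–(9.4.37) HAL p. 626 L46–71 (gloss p. 627 L2–6), (9.4.24) p. 624] -/
theorem lstarSphereG : hsPower 2 gExpV1 = 0 ∧ hsPower 2 gExpJ = 2 := by
  unfold hsPower gExpV1 gExpJ; norm_num

/-- Every `Γ_b` entry keeps its `[v1]` power, since `bExp = 1` in both versions: `|(X̲̂, Ȟ, ω̲̌)|²` (`s = 0`): `0`; `r^{-δ_B}|Ξ̲|²`:
`−δ_B`; `r^{-2}|ě₃(r)|²` (`s = −1`): `0`; `|Ď cos θ|², |e₃(cos θ)|²` (`s = 0`): `0`; `r²(|D⊗̂J|² + |D̄·J̌|² + |∇̌₃J|²)` (`s = 1`): `0`;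
`⋆ℜ`: `r²|B̲|²` (`s = 1`): `0`, `|A̲|²` (`s = 0`): `0`; `L_*` sphere `|𝔡̄Γ_b|²`: `0`.
[cite: KlainermanSzeftel2023, (9.4.1)–(9.4.3) HAL p. 612, Definition 9.2.4 p. 601–602, (9.4.24) p. 624] -/
theorem gammaB_entries (δB : ℝ) :
    hsPower 0 (rate bExp 0) = 0 ∧ hsPower (-δB) (rate bExp 0) = -δB ∧ hsPower (-2) (rate bExp (-1)) = 0 ∧
    hsPower 2 (rate bExp 1) = 0 ∧ hsPower 0 bExp = 0 := by
  unfold hsPower rate bExp; refine ⟨by norm_num, by ring, by norm_num, by norm_num, by norm_num⟩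

/-- Bulk `ᵉˣᵗℜ_k` (9.4.4) / cone-flux `∫_{u=u₁}|Ř|²_{w,k}` entry `r^{3+δ_B}(|A|² + |B|²)`: margin `−δ_B` in `[v1]` (the companion file's
`marginAB_recorded`, audit residue K20b′) and `−2 − δ_B` in `[J]`; the `[J]` radial integrand is `r^{1+δ_B}`.
[cite: KlainermanSzeftel2023, (9.4.4) HAL p. 613 L2–11, (9.4.36)–(9.4.37) p. 626 L46–71, (9.4.24) p. 624; KlainermanSzeftel2021, TeX l.23912–23916, l.24456–24461] -/
theorem bulkAB (δB : ℝ) : margin (wAB δB) (rate gExpV1 1) = -δB ∧ margin (wAB δB) (rate gExpJ 1) = -2 - δB ∧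
    wAB δB + 2 - 2 * rate gExpJ 1 = 1 + δB := by
  unfold margin wAB rate gExpV1 gExpJ; refine ⟨by ring, by ring, by ring⟩

/-- Bulk / cone entry `r^{3−δ_B}|P̌|²`: margin `+δ_B` in `[v1]` (`marginP_recorded`), `−2 + δ_B` in `[J]` — negative for every
`δ_B < 2`; the `[J]` radial integrand is `r^{1−δ_B}`.
[cite: KlainermanSzeftel2023, (9.4.4) HAL p. 613, (9.4.24) p. 624; KlainermanSzeftel2021, TeX l.23912–23916] -/
theorem bulkP (δB : ℝ) : margin (wP δB) (rate gExpV1 1) = δB ∧ margin (wP δB) (rate gExpJ 1) = -2 + δB ∧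
    wP δB + 2 - 2 * rate gExpJ 1 = 1 - δB ∧ (margin (wP δB) (rate gExpJ 1) < 0 ↔ δB < 2) := by
  unfold margin wP rate gExpV1 gExpJ
  refine ⟨by ring, by ring, by ring, ?_⟩
  constructor <;> intro h <;> linarith

/-- Bulk / cone entries `B̲` (`w = 1 − δ_B`, `s = 1`) and `A̲` (`w = −1 − δ_B`, `s = 0`) at the `Γ_b` rate: margin `+δ_B` in both
versions (`marginBb_recorded`, `marginAb_recorded`).  [cite: KlainermanSzeftel2023, (9.4.4) HAL p. 613, (9.4.24) p. 624] -/
theorem bulkBbAb (δB : ℝ) : margin (wBb δB) (rate bExp 1) = δB ∧ margin (wAb δB) (rate bExp 0) = δB := by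
  unfold margin wBb wAb rate bExp; constructor <;> ring

/-- APPLIED, `[J]`: the `(A,B)` radial integral `∫_{r₀}^{R} r^{1+δ_B} dr → ∞` (`δ_B > 0`; already at `δ_B > −2`).
[cite: KlainermanSzeftel2023, (9.4.4), (9.4.24), (3.4.4)] -/
theorem bulkAB_J_unbounded {δB r₀ : ℝ} (hδB : 0 < δB) (hr₀ : 0 < r₀) :
    Tendsto (fun R : ℝ => ∫ x in r₀..R, x ^ (wAB δB + 2 - 2 * rate gExpJ 1)) atTop atTop := by
  have h : wAB δB + 2 - 2 * rate gExpJ 1 = -1 + (2 + δB) := by unfold wAB rate gExpJ; ring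
  simp_rw [h]
  exact radial_unbounded_of_margin_neg (by linarith) hr₀

/-- APPLIED, `[J]`: the `P̌` radial integral `∫_{r₀}^{R} r^{1−δ_B} dr → ∞` for `δ_B < 2` (in `[v1]` it is `≤ r₀^{-δ_B}/δ_B`,
companion `coneFluxPBbAb_recorded_bounded`).  [cite: KlainermanSzeftel2023, (9.4.4), (9.4.24), (3.4.4)] -/
theorem bulkP_J_unbounded {δB r₀ : ℝ} (hδB : δB < 2) (hr₀ : 0 < r₀) :
    Tendsto (fun R : ℝ => ∫ x in r₀..R, x ^ (wP δB + 2 - 2 * rate gExpJ 1)) atTop atTop := by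
  have h : wP δB + 2 - 2 * rate gExpJ 1 = -1 + (2 - δB) := by unfold wP rate gExpJ; ring
  simp_rw [h]
  exact radial_unbounded_of_margin_neg (by linarith) hr₀

/-! ## §4 The second branch of (9.4.24) does not help on `{r = λ}` -/

/-- Where `1 ≤ u ≤ r²` (all of `{r = λ} ∩ ᵉˣᵗ𝓜` once `λ² ≥ u_*`, and the slab `1 ≤ u ≤ 2` once `λ ≥ 2`), branch I is the smaller:
`r^{-1} u^{-(1/2+δ)} ≤ u^{-(1+3δ/4)}` (`δ ≥ 0`), i.e. the two-branch minimum of (9.4.24) IS the branch-I profile there.  [folklore] -/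
theorem branchI_le_branchII {r u δ : ℝ} (hr : 0 < r) (hu : 1 ≤ u) (hur : u ≤ r ^ 2) (hδ : 0 ≤ δ) :
    r⁻¹ * u ^ (-(1 / 2 + δ)) ≤ u ^ (-(1 + 3 * δ / 4)) := by
  have hu0 : 0 < u := by linarith
  have h1 : u ^ (1 / 2 - δ / 4) ≤ r := by
    calc u ^ (1 / 2 - δ / 4) ≤ u ^ ((1:ℝ) / 2) := rpow_le_rpow_of_exponent_le hu (by linarith)
      _ = Real.sqrt u := by rw [Real.sqrt_eq_rpow]
      _ ≤ Real.sqrt (r ^ 2) := Real.sqrt_le_sqrt hur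
      _ = r := Real.sqrt_sq hr.le
  have h2 : r⁻¹ * u ^ (-(1 / 2 + δ)) = r⁻¹ * u ^ (1 / 2 - δ / 4) * u ^ (-(1 + 3 * δ / 4)) := by
    rw [mul_assoc, ← rpow_add hu0]; congr 2; ring
  rw [h2]
  calc r⁻¹ * u ^ (1 / 2 - δ / 4) * u ^ (-(1 + 3 * δ / 4))
      ≤ r⁻¹ * r * u ^ (-(1 + 3 * δ / 4)) := by gcongr
    _ = u ^ (-(1 + 3 * δ / 4)) := by rw [inv_mul_cancel₀ hr.ne', one_mul]

/-- The same, as the two-branch minimum.  [folklore] -/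
theorem twoBranch_min_eq {r u δ : ℝ} (hr : 0 < r) (hu : 1 ≤ u) (hur : u ≤ r ^ 2) (hδ : 0 ≤ δ) :
    min (r⁻¹ * u ^ (-(1 / 2 + δ))) (u ^ (-(1 + 3 * δ / 4))) = r⁻¹ * u ^ (-(1 / 2 + δ)) :=
  min_eq_left (branchI_le_branchII hr hu hur hδ)

/-- The `{r = λ}`-integrand of the principal Ricci block of `ᵉˣᵗ𝔊_k` at the `[J]` two-branch rate, per unit `ε₀²` and after the
angular integration: weight `r²` × area `r²` × `min(branch I, branch II)²`.  [cite: KlainermanSzeftel2023, (9.4.3) p. 612, (9.4.24) p. 624] -/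
def ricciSlabJ (δ lam u : ℝ) : ℝ := lam ^ (4:ℝ) * (min (lam⁻¹ * u ^ (-(1 / 2 + δ))) (u ^ (-(1 + 3 * δ / 4)))) ^ 2

/-- On the slab `1 ≤ u ≤ 2` of a hypersurface `{r = λ}`, `λ ≥ 2`: `ricciSlabJ δ λ u = λ² · u^{-(1+2δ)}`.  [folklore] -/
theorem ricciSlabJ_eq {δ lam u : ℝ} (hδ : 0 ≤ δ) (hl : 2 ≤ lam) (hu : 1 ≤ u) (hu2 : u ≤ 2) :
    ricciSlabJ δ lam u = lam ^ (2:ℝ) * u ^ (-(1 + 2 * δ)) := by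
  have hl0 : 0 < lam := by linarith
  have hu0 : 0 < u := by linarith
  have hur : u ≤ lam ^ 2 := by nlinarith
  unfold ricciSlabJ
  rw [twoBranch_min_eq hl0 hu hur hδ, mul_pow, ← rpow_natCast (u ^ (-(1 / 2 + δ))) 2, ← rpow_mul hu0.le]
  have h1 : (lam⁻¹) ^ 2 = lam ^ (-(2:ℝ)) := by
    rw [rpow_neg hl0.le, rpow_two, inv_pow]
  have h2 : -(1 / 2 + δ) * ((2:ℕ):ℝ) = -(1 + 2 * δ) := by push_cast; ring
  rw [h1, h2, ← mul_assoc, ← rpow_add hl0]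
  norm_num

/-- Hence `∫_1^2 ricciSlabJ δ λ u du = λ² · (1 − 2^{-2δ})/(2δ)` for `λ ≥ 2`, `δ > 0`: a lower bound for the `{r = λ}` term of `ᵉˣᵗ𝔊_k`
per unit `ε₀²` (the slab lies in `ᵉˣᵗ𝓜` as soon as `u_* ≥ 2`).  [folklore] -/
theorem ricciSlab_integral {δ lam : ℝ} (hδ : 0 < δ) (hl : 2 ≤ lam) :
    ∫ u in (1:ℝ)..2, ricciSlabJ δ lam u = lam ^ (2:ℝ) * ((1 - 2 ^ (-(2 * δ))) / (2 * δ)) := by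
  have hcongr : ∫ u in (1:ℝ)..2, ricciSlabJ δ lam u = ∫ u in (1:ℝ)..2, lam ^ (2:ℝ) * u ^ (-(1 + 2 * δ)) := by
    refine intervalIntegral.integral_congr fun u hu => ?_
    rw [uIcc_of_le (by norm_num : (1:ℝ) ≤ 2)] at hu
    exact ricciSlabJ_eq hδ.le hl hu.1 hu.2
  rw [hcongr, intervalIntegral.integral_const_mul]
  congr 1
  have h0 : (0:ℝ) ∉ uIcc (1:ℝ) 2 := by
    rw [uIcc_of_le (by norm_num : (1:ℝ) ≤ 2)]; intro h; exact absurd h.1 (by norm_num)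
  have hne : -(1 + 2 * δ) ≠ -1 := by intro h; linarith
  rw [integral_rpow (Or.inr ⟨hne, h0⟩)]
  have h1 : -(1 + 2 * δ) + 1 = -(2 * δ) := by ring
  rw [h1, one_rpow]
  have h2 : (2:ℝ) * δ ≠ 0 := ne_of_gt (by linarith)
  field_simp
  ring

/-- … which is unbounded in `λ`: `λ² · (1 − 2^{-2δ})/(2δ) → ∞` (`1 − 2^{-2δ} > 0`).  With `λ` up to `r_*` this is the factor of §5.
[cite: KlainermanSzeftel2023, (9.4.3), (9.4.24), (9.4.33) HAL p. 626 L30–37] -/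
theorem ricciSlab_unbounded {δ : ℝ} (hδ : 0 < δ) :
    Tendsto (fun lam : ℝ => lam ^ (2:ℝ) * ((1 - 2 ^ (-(2 * δ))) / (2 * δ))) atTop atTop := by
  have hc : 0 < (1 - (2:ℝ) ^ (-(2 * δ))) / (2 * δ) := by
    apply div_pos _ (by linarith)
    have : (2:ℝ) ^ (-(2 * δ)) < 1 := Real.rpow_lt_one_of_one_lt_of_neg (by norm_num) (by linarith)
    linarith
  exact Tendsto.atTop_mul_const hc (tendsto_rpow_atTop two_pos)

/-- CONTRAST, `[v1]`: the same block at the `r² u^{1/2+δ}` weight has `{r = λ}`-integrand `λ⁴ · (λ^{-2} u^{-(1/2+δ)})² = u^{-(1+2δ)}`,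
free of `λ`, and `∫_1^{U} u^{-1-2δ} du ≤ 1/(2δ)` uniformly in `U ≥ 1` — the entry is exactly critical and closes.
[cite: KlainermanSzeftel2021, TeX l.24414–24419 with l.23896–23910] -/
theorem ricci_v1_bounded {δ lam U : ℝ} (hδ : 0 < δ) (hl : 0 < lam) (hU : 1 ≤ U) :
    (∀ u : ℝ, 0 < u → lam ^ (4:ℝ) * (lam ^ (-(2:ℝ)) * u ^ (-(1 / 2 + δ))) ^ 2 = u ^ (-1 - 2 * δ)) ∧
    ∫ u in (1:ℝ)..U, u ^ (-1 - 2 * δ) ≤ 1 / (2 * δ) := by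
  refine ⟨fun u hu => ?_, ?_⟩
  · rw [mul_pow, ← rpow_natCast (lam ^ (-(2:ℝ))) 2, ← rpow_mul hl.le, ← rpow_natCast (u ^ (-(1 / 2 + δ))) 2,
      ← rpow_mul hu.le, ← mul_assoc, ← rpow_add hl]
    have h1 : (4:ℝ) + -(2:ℝ) * ((2:ℕ):ℝ) = 0 := by push_cast; ring
    have h2 : -(1 / 2 + δ) * ((2:ℕ):ℝ) = -1 - 2 * δ := by push_cast; ring
    rw [h1, h2, rpow_zero, one_mul]
  · have := radial_bounded_of_margin_pos (by linarith : 0 < 2 * δ) one_pos hU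
    simpa [Real.one_rpow] using this

/-! ## §5 The size of a power `2` at the outer radius -/

/-- At `R = r_* = δ_* ε₀^{-1} u_*^{1+δ_dec}`: `ε₀² · R² = δ_*² · u_*^{2+2δ_dec}` — the `[J]` power `2` converts the `ε₀²` of (9.4.33)
into a quantity with no `ε₀` at all, growing in `u_*`.  [cite: KlainermanSzeftel2021, (3.4.5) TeX l.6103–6106; KlainermanSzeftel2023, (3.4.5), (9.4.33) HAL p. 626] -/
theorem eps_sq_rstar_sq {δstar ε₀ ustar δdec : ℝ} (hδ : 0 < δstar) (hε : 0 < ε₀) (hu : 0 < ustar) :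
    ε₀ ^ (2:ℝ) * (δstar * ε₀⁻¹ * ustar ^ (1 + δdec)) ^ (2:ℝ) = δstar ^ (2:ℝ) * ustar ^ (2 + 2 * δdec) := by
  rw [rstar_pow (δB := 2) hδ hε hu]
  have h1 : ε₀ ^ (2:ℝ) * ε₀ ^ (-(2:ℝ)) = 1 := by rw [← rpow_add hε]; norm_num
  have h2 : (1 + δdec) * 2 = 2 + 2 * δdec := by ring
  rw [h2]
  calc ε₀ ^ (2:ℝ) * (δstar ^ (2:ℝ) * ε₀ ^ (-(2:ℝ)) * ustar ^ (2 + 2 * δdec))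
      = (ε₀ ^ (2:ℝ) * ε₀ ^ (-(2:ℝ))) * δstar ^ (2:ℝ) * ustar ^ (2 + 2 * δdec) := by ring
    _ = δstar ^ (2:ℝ) * ustar ^ (2 + 2 * δdec) := by rw [h1, one_mul]

/-- … and `δ_*² u_*^{2+2δ_dec} → ∞` as `u_* → ∞` (`δ_* > 0`, `δ_dec ≥ 0`): not `O(ε₀²)` uniformly in `u_*`, which is what (9.4.33)
`𝔊_{k_small−1} + ℜ_{k_small−1} ≲ ε₀` requires of every entry.  [cite: KlainermanSzeftel2023, (9.4.33) HAL p. 626 L30–37] -/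
theorem rstar_factor_unbounded {δstar δdec : ℝ} (hδ : 0 < δstar) (hdec : 0 ≤ δdec) :
    Tendsto (fun ustar : ℝ => δstar ^ (2:ℝ) * ustar ^ (2 + 2 * δdec)) atTop atTop :=
  Tendsto.const_mul_atTop (rpow_pos_of_pos hδ _) (tendsto_rpow_atTop (by linarith))

/-! ## §6 What the arXiv weight buys back -/

/-- With the `Γ'_g` parameter at its `[v1]` value `2` every hypersurface power of the table is `≤ 0` except `⋆ℜ[(A,B)] = δ_B`, and every
bulk margin is `+δ_B` except `(A,B)`'s `−δ_B`: the companion file's table (its `marginAB_recorded`, `marginP_recorded`,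
`starPowerB_recorded`), whose only supercritical entries are the `(A,B)` ones (audit residue K20b′).  The `[J]` print does not
contain this weight.  [cite: KlainermanSzeftel2021, TeX l.24414–24419; KlainermanSzeftel2023, (9.4.24) HAL p. 624] -/
theorem v1_table (δB : ℝ) :
    hsPower 2 (rate gExpV1 0) = 0 ∧ hsPower (2 - δB) (rate gExpV1 0) = -δB ∧ hsPower 0 (rate gExpV1 (-1)) = 0 ∧
    hsPower 4 (rate gExpV1 1) = 0 ∧ hsPower 2 gExpV1 = 0 ∧ hsPower (wABstar δB) (rate gExpV1 1) = δB ∧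
    margin (wAB δB) (rate gExpV1 1) = -δB ∧ margin (wP δB) (rate gExpV1 1) = δB := by
  unfold hsPower rate gExpV1 wABstar margin wAB wP
  refine ⟨by norm_num, by ring, by norm_num, by norm_num, by norm_num, by ring, by ring, by ring⟩

/-- The `[J]` column in one line: the six `Γ_g`-fed entries carry the powers `2, 2 − δ_B, 2, 2 + δ_B, 2, 2` and the two `Γ_g`-fed bulk
margins are `−2 − δ_B`, `−2 + δ_B`; i.e. each is the `[v1]` value plus `2` (hypersurface) / minus `2` (margin) — one factor `r²`
per squared entry, uniformly.  [cite: KlainermanSzeftel2023, (9.4.24) HAL p. 624, (9.4.1)–(9.4.4) p. 612–613] -/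
theorem J_table (δB : ℝ) :
    hsPower 2 (rate gExpJ 0) = 2 ∧ hsPower (2 - δB) (rate gExpJ 0) = 2 - δB ∧ hsPower 0 (rate gExpJ (-1)) = 2 ∧
    hsPower (wABstar δB) (rate gExpJ 1) = 2 + δB ∧ hsPower 4 (rate gExpJ 1) = 2 ∧ hsPower 2 gExpJ = 2 ∧
    margin (wAB δB) (rate gExpJ 1) = -2 - δB ∧ margin (wP δB) (rate gExpJ 1) = -2 + δB := by
  unfold hsPower rate gExpJ wABstar margin wAB wP
  refine ⟨by norm_num, by ring, by norm_num, by ring, by norm_num, by norm_num, by ring, by ring⟩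

/-- The uniform shift: for every weight `w` and normalisation `s`, `hsPower w (rate gExpJ s) = hsPower w (rate gExpV1 s) + 2` and
`margin w (rate gExpJ s) = margin w (rate gExpV1 s) − 2`.  [folklore] -/
theorem J_shift (w s : ℝ) : hsPower w (rate gExpJ s) = hsPower w (rate gExpV1 s) + 2 ∧
    margin w (rate gExpJ s) = margin w (rate gExpV1 s) - 2 := by
  unfold hsPower margin rate gExpJ gExpV1; constructor <;> ring


/-! ## §7 The companion near-zone and mixed counts at the `[J]` print, read literally -/

/-- `[J]`, literal: zone II (`u^{1/2−δ/4} ≤ r ≤ u`, branch I profile `r^{-2}u^{-(1/2+δ)}` of `B'`, `rB' ∈ Γ'_g`): `r`-integrand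
`r^{3+δ_B}·r^{-4}·r² = r^{1+δ_B}`, `∫^{u} ≤ u^{2+δ_B}/(2+δ_B)`, times `u^{-1-2δ}`: `u`-exponent `1 + δ_B − 2δ` — the companion's
`NearZoneCount.uExpII δ_B δ` plus `2`.  [cite: KlainermanSzeftel2023, (9.4.24) HAL p. 624 with (9.4.4) p. 613] -/
def uExpII_J (δB δ : ℝ) : ℝ := 1 + δB - 2 * δ

/-- `[J]`, literal: zone I (`r ≤ u^{1/2−δ/4}`, branch II profile `r^{-1}u^{-(1+3δ/4)}`): `r^{3+δ_B}·r^{-2}·r² = r^{3+δ_B}`,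
`∫^{√u} ≤ u^{(4+δ_B)/2}/(4+δ_B)`, times `u^{-2-3δ/2}`: `u`-exponent `δ_B/2 − 3δ/2` (companion: `δ_B/2 − 1 − 2δ`).
[cite: KlainermanSzeftel2023, (9.4.24) HAL p. 624 with (9.4.4) p. 613] -/
def uExpI_J (δB δ : ℝ) : ℝ := δB / 2 - 3 * δ / 2

/-- Bookkeeping of zone II at `[J]` and the shift by `2` against the companion.  [folklore] -/
theorem uExpII_J_eq (δB δ : ℝ) : (wAB δB - 2 * rate gExpJ 1 + 2) + 1 + (-(2 * uExpI δ)) = uExpII_J δB δ ∧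
    uExpII_J δB δ = NearZoneCount.uExpII δB δ + 2 := by
  unfold wAB rate gExpJ uExpI uExpII_J NearZoneCount.uExpII; constructor <;> ring

/-- Bookkeeping of zone I at `[J]` (branch II: `r`-exponent `gExpJ' + 1 = 1` for `B'`, `u`-exponent `2·uExpII`).  [folklore] -/
theorem uExpI_J_eq (δB δ : ℝ) : ((wAB δB - 2 * rate gExpJ' 1 + 2) + 1) / 2 + (-(2 * uExpII δ)) = uExpI_J δB δ ∧
    uExpI_J δB δ = NearZoneCount.uExpI δB δ + 1 + δ / 2 := by
  unfold wAB rate gExpJ' uExpII uExpI_J NearZoneCount.uExpI; constructor <;> ring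

/-- Neither zone is `u`-integrable at infinity at the literal `[J]` print, for ANY `δ_B > 0` and `δ ≤ 2/3`: both exponents are
`> −1` (companion at the PG / `[v1]` profile: zone II integrable iff `δ_B < 2δ_X`, zone I iff `δ_B < 4δ_X` — a WINDOW; here none).
[cite: KlainermanSzeftel2023, (9.4.24) HAL p. 624, (9.4.4) p. 613, (3.4.4)] -/
theorem zones_J_not_integrable {δB δ : ℝ} (hδB : 0 < δB) (hδ : δ ≤ 2 / 3) :
    -1 < uExpII_J δB δ ∧ -1 < uExpI_J δB δ := by
  unfold uExpII_J uExpI_J; constructor <;> linarith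

/-- APPLIED: `∫_1^{U} u^{uExpII_J} du → ∞` (`δ_B > 0`, `δ ≤ 2/3`).  [cite: KlainermanSzeftel2023, (9.4.24), (9.4.4), (3.4.4)] -/
theorem zoneII_J_unbounded {δB δ : ℝ} (hδB : 0 < δB) (hδ : δ ≤ 2 / 3) :
    Tendsto (fun U : ℝ => ∫ u in (1:ℝ)..U, u ^ uExpII_J δB δ) atTop atTop := by
  have h : uExpII_J δB δ = -1 + (2 + δB - 2 * δ) := by unfold uExpII_J; ring
  rw [h]
  exact radial_unbounded_of_margin_neg (by linarith) one_pos

/-- MIXED count at the literal `[J]` print: the `ε₀`-size pointwise input for `B'` at rate `2` (branch I) has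
`μ_J := −margin(3+δ_B, 2) = 2 + δ_B` (companion `MixedRateCount.mu` at the ch. 6 improved PG rate: `δ_B + δ_dec − δ_extra`).
[cite: KlainermanSzeftel2023, (9.4.24) HAL p. 624, (9.4.4) p. 613] -/
def muJ (δB : ℝ) : ℝ := -margin (wAB δB) (rate gExpJ 1)

/-- `μ_J = 2 + δ_B`.  [folklore] -/
theorem muJ_eq (δB : ℝ) : muJ δB = 2 + δB := by unfold muJ margin wAB rate gExpJ; ring

/-- … so the mixing window `μ < 2·m·δ_X` (`m = 1` = BA-B's margin `MixedRateCount.marginAB_bounded`, `δ_X = δ_dec`) FAILS for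
every `δ_B > 0`, `δ_dec < 1`: the `u`-margin is negative and the mixed `u`-integral is unbounded in the bootstrap time
(companion `uMargin_neg_iff`, `uIntegral_unbounded`).  [cite: KlainermanSzeftel2023, (9.4.24) HAL p. 624; KlainermanSzeftel2021, BA-B TeX l.5811–5815] -/
theorem mixingWindow_J_fails {δB δdec : ℝ} (hδB : 0 < δB) (hdec : δdec < 1) :
    MixedRateCount.uMargin δdec (muJ δB) 1 < 0 ∧
    Tendsto (fun U : ℝ => ∫ u in (1:ℝ)..U, u ^ (-1 - MixedRateCount.uMargin δdec (muJ δB) 1)) atTop atTop := by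
  have hμ : 0 < muJ δB + 1 := by rw [muJ_eq]; linarith
  have hneg : MixedRateCount.uMargin δdec (muJ δB) 1 < 0 := by
    rw [MixedRateCount.uMargin_neg_iff hμ, muJ_eq]; linarith
  exact ⟨hneg, MixedRateCount.uIntegral_unbounded hneg⟩

end Literature.Geometry.Lorentzian.KlainermanSzeftel2021.RefereedRateCount

end
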